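import Literature.AlgebraicGeometry.Resolution.AlterationsInduction
import Mathlib.AlgebraicGeometry.Morphisms.Smooth
import Mathlib.AlgebraicGeometry.Morphisms.Flat
import Mathlib.AlgebraicGeometry.Morphisms.FinitePresentation
import Mathlib.AlgebraicGeometry.Morphisms.UniversallyOpen
import Mathlib.RingTheory.AdicCompletion.Algebra
import Mathlib.RingTheory.MvPowerSeries.Basic
import Mathlib.FieldTheory.IsAlgClosed.AlgebraicClosure
import HarnessLib

/-!
# De Jong's alteration theorem: the step 4.11–4.28 split at Situation 4.23 (de Jong 1996)

Topic: `Literature/AlgebraicGeometry/Resolution`. Companion to `AlterationsInduction.lean`, which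
vendors the deep half of the printed proof of de Jong 1996, Thm. 4.1 — 4.11–4.28, Thm. 4.1 for
normal projective pairs `(X, Z)` of dimension `d + 1` over an algebraically closed field from
Thm. 4.1 in dimension `≤ d` — as ONE named fact `DeJong1996NormalProjectiveStep`. This file is
the first layer of its decomposition, cut where the printed text itself restarts:

> "Pulling back the family `𝒞` to a family `𝒳` over `Y'` and applying 4.4 once again, we reduce
> to the situation described in 4.23 below. (We drop the stability hypothesis, since we will not
> need it any more.) **4.23. Situation.** Here `Y` is a nonsingular projective variety over the
> algebraically closed field `k`, `D ⊂ Y` is a divisor with strict normal crossings, and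
> `f : X → Y` is a semi-stable curve, smooth over `Y ∖ D`. The closed subset `Z ⊂ X` equals
> `τ₁(Y) ∪ … ∪ τₙ(Y) ∪ f⁻¹(D)`, where `τᵢ`, `1 ≤ i ≤ n` are mutually disjoint sections into the
> smooth locus of `f`, i.e. `τᵢ : Y → sm(X/Y)`." (p. 75)

Everything before (4.11–4.22: the Lefschetz pencil Lemma 4.11, Stein factorisation 4.12, the
multisection Lemma 4.13–4.14, generically étale base changes 4.15, Galois normalisation 4.16, the
projective level-`ℓ` moduli scheme of stable `n`-pointed curves 4.17/2.24, flattening 2.19 and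
the three-point Lemma 4.18–4.21, and 4.22, where THE INDUCTION HYPOTHESIS is applied to the base
`(Y, D)`, `dim Y = dim X - 1`) serves to reach Situation 4.23 along generically étale
alterations (4.4) and enlargements of `Z` (4.9); everything after (4.24–4.28: Lemma 3.2 and 3.5,
the explicit blow-ups 4.26–4.27, and 2.4) resolves the pair of Situation 4.23 by a modification.
Accordingly this file

* defines **semi-stable curves over a base** (de Jong 1996, 2.21: "a flat proper `f : X → S` of
  finite presentation, such that all geometric fibres are connected curves having at most
  ordinary double points as singularities"), `IsSemiStableCurve f`, with the ordinary double
  point rendered by its complete local ring `K⟦u, v⟧/(uv)` over an algebraically closed field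
  (loc. cit. 2.23), `IsOrdinaryDoublePoint`;
* defines **Situation 4.23**, `DeJong1996.SemiStablePair f g D τ`, for `f : X → Y`,
  `g : Y → Spec k`, `D ⊆ Y`, sections `τ : Fin n → (Y ⟶ X)`, together with the running
  hypotheses of the pair `(X, Z)` that the text keeps implicitly ("the pair": `X` a variety, 2.9;
  "(iii) `X` is projective", preserved "as long as we only take projective alterations", 4.10,
  4.15, and asserted again in 4.25); its boundary is `Z = ⋃ᵢ τᵢ(Y) ∪ f⁻¹(D)`;
* vendors the two halves as NAMED FACTS with the source's numbering:
  `DeJong1996ReductionToSemiStablePair` (4.11–4.22: over an algebraically closed `k`, given Thm. 4.1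
  with its generically-étale clause in dimension `≤ d`, Thm. 4.1 with the clause for a normal
  projective pair of dimension `d + 1` follows from Thm. 4.1 with the clause for all pairs in
  Situation 4.23 over `k` of the same dimension) and `DeJong1996SemiStablePairResolution`
  (4.23–4.28: Thm. 4.1 with the clause holds for every pair in Situation 4.23);
* PROVES the assembly `DeJong1996NormalProjectiveStep.of_semiStablePair` and its composites
  down to `DeJong1996Strong`/`DeJong1996Projective`; the bookkeeping API of Situation 4.23 —
  `X → Spec k` is proper, `f η_X = η_Y` (`f` is flat of finite presentation, hence open, hence
  dominant), the sections are closed immersions, the boundary `Z` is closed and is a PROPER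
  subset: `η_X ∉ f⁻¹(D)` (`η_Y ∉ D`, the local ring of a strict normal crossings divisor having
  dimension `r + e ≥ 1` while `𝒪_{Y,η}` is a field) and `η_X ∉ τᵢ(Y)` (otherwise the closed
  immersion `τᵢ` is onto, hence an isomorphism with inverse `f`, and a geometric fibre of `f` is
  a point `Spec K`, whose local ring `K` is neither regular of dimension `1` nor an ordinary
  double point — `K⟦u, v⟧/(uv)` is not a domain, the completion of a field is); and the two
  sanity implications of the cut,
  `DeJong1996NormalProjectiveStep → DeJong1996ReductionToSemiStablePair` and
  `DeJong1996StrongAlgClosed → DeJong1996SemiStablePairResolution` (a pair in Situation 4.23 is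
  a pair as in Thm. 4.1).

Both named facts are nodes to be decomposed further (4.11–4.12 | 4.13–4.17 | 4.18–4.22, and
4.24 | 4.25–4.28); the owning literature unit's `NOTES.md` keeps the DAG.

## Sources

* A. J. de Jong, *Smoothness, semi-stability and alterations*, Publ. Math. IHÉS 83 (1996) 51–93:
  2.4, 2.9, 2.20, 2.21–2.23 (pp. 55, 61–62), §3 (3.1–3.5, pp. 62–64), Thm. 4.1 (p. 66), 4.4, 4.9,
  4.10 (pp. 66–67), Lemma 4.11–4.22 (pp. 67–75), 4.23–4.28 (pp. 75–76).
-/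

noncomputable section

open CategoryTheory CategoryTheory.Limits AlgebraicGeometry TopologicalSpace Topology

namespace Literature.AlgebraicGeometry.Resolution

universe u

/-! ## Semi-stable curves over a base (de Jong 1996, 2.21–2.23) -/

/-- **Ordinary double point over an algebraically closed field** (de Jong 1996, 2.21 and 2.23):
the point `x` of the scheme `C` (in applications: a closed point of a geometric fibre, a scheme
of finite type over the algebraically closed field `K`) is an ordinary double point, i.e. the
completion of its local ring is isomorphic to `K⟦u, v⟧/(uv)` — 2.23: "By assumption of
semi-stability we have that `B/𝔪_A B ≅ k'⟦u, v⟧/(q)`, where `q` is a quadratic form with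
nonvanishing discriminant", and over an algebraically closed field every such `q` is equivalent
to `uv` (loc. cit.: "If `f` is split … we may choose `q = uv`"). The completion is Mathlib's
`AdicCompletion` of the stalk `𝒪_{C,x}` at its maximal ideal, `K⟦u, v⟧` is
`MvPowerSeries (Fin 2) K`; an isomorphism of rings is required (for a closed point of a scheme of
finite type over the algebraically closed `K` this is equivalent to a `K`-algebra isomorphism:
both sides are then complete local `K`-algebras with residue field `K`, reduced with two
regular one-dimensional branches meeting transversally). [cite: DeJong1996, 2.23, pp. 61–62] -/
def IsOrdinaryDoublePoint (K : Type u) [Field K] {C : Scheme.{u}} (x : C) : Prop :=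
  Nonempty
    (AdicCompletion (IsLocalRing.maximalIdeal (C.presheaf.stalk x)) (C.presheaf.stalk x) ≃+*
      MvPowerSeries (Fin 2) K ⧸
        Ideal.span {(MvPowerSeries.X 0 * MvPowerSeries.X 1 : MvPowerSeries (Fin 2) K)})

namespace IsOrdinaryDoublePoint

/-- Distinct variables do not divide each other in a power series ring: the coefficient of `Xᵢ`
at the monomial `Xᵢ` is `1`, while every multiple of `Xⱼ` has coefficient `0` there.
[folklore] -/
theorem not_X_dvd_X_of_ne {σ : Type*} {R : Type*} [CommSemiring R] [Nontrivial R] {i j : σ}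
    (h : i ≠ j) : ¬ (MvPowerSeries.X j : MvPowerSeries σ R) ∣ MvPowerSeries.X i := by
  classical
  intro hd
  have h0 := (MvPowerSeries.X_dvd_iff.mp hd) (Finsupp.single i 1)
    (by rw [Finsupp.single_apply, if_neg h])
  rw [MvPowerSeries.coeff_index_single_self_X] at h0
  exact one_ne_zero h0

/-- The complete local ring `K⟦u, v⟧/(uv)` of an ordinary double point is not a domain:
`u · v = 0` while `u ≠ 0` and `v ≠ 0`. [folklore] -/
theorem not_isDomain_quotient (K : Type u) [Field K] :
    ¬ IsDomain (MvPowerSeries (Fin 2) K ⧸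
      Ideal.span {(MvPowerSeries.X 0 * MvPowerSeries.X 1 : MvPowerSeries (Fin 2) K)}) := by
  set J : Ideal (MvPowerSeries (Fin 2) K) :=
    Ideal.span {(MvPowerSeries.X 0 * MvPowerSeries.X 1 : MvPowerSeries (Fin 2) K)} with hJ
  intro hD
  have hne : ∀ {i j : Fin 2}, i ≠ j → Ideal.Quotient.mk J (MvPowerSeries.X i) ≠ 0 := by
    intro i j hij h0
    rw [Ideal.Quotient.eq_zero_iff_mem, hJ, Ideal.mem_span_singleton] at h0
    refine not_X_dvd_X_of_ne hij (dvd_trans ?_ h0)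
    fin_cases j
    · exact dvd_mul_right _ _
    · exact dvd_mul_left _ _
  have hzero : Ideal.Quotient.mk J (MvPowerSeries.X 0) * Ideal.Quotient.mk J (MvPowerSeries.X 1) =
      0 := by
    rw [← map_mul, Ideal.Quotient.eq_zero_iff_mem, hJ]
    exact Ideal.subset_span rfl
  rcases mul_eq_zero.mp hzero with h | h
  · exact hne (i := 0) (j := 1) (by decide) h
  · exact hne (i := 1) (j := 0) (by decide) h

/-- The `𝔪`-adic completion of a local ring which is a field is a domain (it is the field
itself, `𝔪 = 0`). [folklore] -/
theorem isDomain_adicCompletion_of_isField {R : Type u} [CommRing R] [IsLocalRing R]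
    (hR : IsField R) : IsDomain (AdicCompletion (IsLocalRing.maximalIdeal R) R) := by
  have hm : IsLocalRing.maximalIdeal R = ⊥ := IsLocalRing.isField_iff_maximalIdeal_eq.mp hR
  haveI : IsAdicComplete (IsLocalRing.maximalIdeal R) R := by rw [hm]; infer_instance
  haveI := hR.isDomain
  exact MulEquiv.isDomain R (AdicCompletion.ofAlgEquiv (IsLocalRing.maximalIdeal R)).symm.toMulEquiv

/-- A point whose local ring is a field (e.g. the generic point of an integral scheme) is not an
ordinary double point. [folklore] -/
theorem not_of_isField (K : Type u) [Field K] {C : Scheme.{u}} {x : C}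
    (hx : IsField (C.presheaf.stalk x)) : ¬ IsOrdinaryDoublePoint K x := by
  rintro ⟨e⟩
  haveI := isDomain_adicCompletion_of_isField hx
  exact not_isDomain_quotient K (MulEquiv.isDomain _ e.symm.toMulEquiv)

end IsOrdinaryDoublePoint

/-- **Semi-stable curve over a base** (de Jong 1996, 2.21): "Let `S` be a scheme. A semi-stable
curve `X` over `S` is a flat proper `f : X → S` of finite presentation, such that all geometric
fibres are connected curves having at most ordinary double points as singularities." Rendered:
`f` is flat, proper (hence quasi-compact and separated) and locally of finite presentation, and
for every algebraically closed field `K` and every `s̄ : Spec K → S` the geometric fibre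
`X_s̄ = X ×_S Spec K` (Mathlib's `pullback f s̄`) is connected (in particular non-empty) and each
of its closed points `x` is either a nonsingular point of a curve — the local ring
`𝒪_{X_s̄,x}` is regular of dimension `1` (over the algebraically closed `K`, regular = smooth,
loc. cit. 2.10) — or an ordinary double point (`IsOrdinaryDoublePoint`, 2.23); this forces
`X_s̄` to be a reduced curve, i.e. equidimensional of dimension `1`.
[cite: DeJong1996, 2.21, p. 61] -/
structure IsSemiStableCurve {X S : Scheme.{u}} (f : X ⟶ S) : Prop where
  /-- `f` is flat -/
  flat : Flat f
  /-- `f` is proper -/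
  isProper : IsProper f
  /-- `f` is (locally, hence — being proper — globally) of finite presentation -/
  locallyOfFinitePresentation : LocallyOfFinitePresentation f
  /-- every geometric fibre is connected (in particular non-empty) -/
  connectedSpace_pullback : ∀ (K : Type u) [Field K] [IsAlgClosed K] (s : Spec (.of K) ⟶ S),
    ConnectedSpace ↥(pullback f s)
  /-- every closed point of a geometric fibre is a nonsingular point of a curve or an ordinary
  double point -/
  isRegularLocalRing_or_isOrdinaryDoublePoint :
    ∀ (K : Type u) [Field K] [IsAlgClosed K] (s : Spec (.of K) ⟶ S) (x : ↥(pullback f s)),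
      IsClosed ({x} : Set ↥(pullback f s)) →
        (IsRegularLocalRing ((pullback f s).presheaf.stalk x) ∧
            ringKrullDim ((pullback f s).presheaf.stalk x) = 1) ∨
          IsOrdinaryDoublePoint K x

namespace IsSemiStableCurve

variable {X S : Scheme.{u}} {f : X ⟶ S}

/-- A semi-stable curve is universally open (flat and locally of finite presentation).
[folklore] -/
theorem universallyOpen (h : IsSemiStableCurve f) : UniversallyOpen f :=
  haveI := h.flat
  haveI := h.locallyOfFinitePresentation
  inferInstance

/-- A semi-stable curve is separated. [folklore] -/
theorem isSeparated (h : IsSemiStableCurve f) : IsSeparated f :=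
  haveI := h.isProper
  inferInstance

/-- A semi-stable curve over an irreducible base with non-empty source is dominant (it is an
open map). [folklore] -/
theorem isDominant (h : IsSemiStableCurve f) [IrreducibleSpace S] [Nonempty X] :
    IsDominant f := by
  haveI := h.universallyOpen
  refine ⟨?_⟩
  have ho : IsOpen (Set.range f) := f.isOpenMap.isOpen_range
  exact ho.dense (Set.range_nonempty _)

end IsSemiStableCurve

/-! ## The generic point is off every strict normal crossings divisor -/

/-- The generic point of an integral scheme does not lie on a strict normal crossings divisor of
it: at a point of the divisor the local ring has dimension `r + e ≥ 1`, while the local ring at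
the generic point is the function field. [folklore] -/
theorem IsStrictNormalCrossingsDivisor.genericPoint_notMem {Y : Scheme.{u}} [IsIntegral Y]
    {D : Set Y} (hD : IsStrictNormalCrossingsDivisor Y D) : genericPoint Y ∉ D := by
  intro hη
  obtain ⟨r, e, x, y, hr, hdim, -, -⟩ := hD.exists_regularSystemOfParameters hη
  have h0 : ringKrullDim (Y.presheaf.stalk (genericPoint Y)) = 0 :=
    ringKrullDim_eq_zero_of_field Y.functionField
  rw [h0] at hdim
  have : (0 : WithBot ℕ∞) ≠ ((r + e : ℕ) : WithBot ℕ∞) := by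
    have hne : (0 : ℕ) ≠ r + e := by omega
    exact_mod_cast hne
  exact this hdim

/-! ## Situation 4.23 -/

namespace DeJong1996

/-- **de Jong 1996, Situation 4.23** for the pair `(X, Z)`, `Z = ⋃ᵢ τᵢ(Y) ∪ f⁻¹(D)`: "Here `Y`
is a nonsingular projective variety over the algebraically closed field `k`, `D ⊂ Y` is a
divisor with strict normal crossings, and `f : X → Y` is a semi-stable curve, smooth over
`Y ∖ D`. The closed subset `Z ⊂ X` equals `τ₁(Y) ∪ … ∪ τₙ(Y) ∪ f⁻¹(D)`, where `τᵢ`,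
`1 ≤ i ≤ n` are mutually disjoint sections into the smooth locus of `f`, i.e.
`τᵢ : Y → sm(X/Y)`." Together with the running hypotheses on "the pair `(X, Z)`" of the proof
(4.4): `X` is a variety (2.9: integral; it is separated of finite type over `k`, being proper
over the projective `Y`) and "(iii) `X` is projective" (4.7; kept throughout 4.10–4.22 "as long
as we only take projective alterations", and restated in 4.25 "Here `X` is a projective variety").
Fields: `Y` integral, projective over `k` (`IsProjectiveOver`) and regular (`Scheme.IsRegular`,
"nonsingular"); `D` a strict normal crossings divisor (`IsStrictNormalCrossingsDivisor`, 2.4);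
`f` a semi-stable curve (`IsSemiStableCurve`, 2.21), smooth over the open `Y ∖ D`; `τᵢ ≫ f = 𝟙`,
the images `τᵢ(Y)` pairwise disjoint, each contained in an open of `X` on which `f` is smooth
(the smooth locus `sm(X/Y)`, 2.5, is open). The number `n` of sections is not constrained (in
the text it is the `n ≥ 3` of (vi) e)–g), a bound that 4.23–4.28 never use: "We drop the
stability hypothesis, since we will not need it any more"). [cite: DeJong1996, 4.23, p. 75] -/
structure SemiStablePair {k : Type u} [Field k] {X Y : Scheme.{u}} (f : X ⟶ Y)
    (g : Y ⟶ Spec (.of k)) (D : Set Y) {n : ℕ} (τ : Fin n → (Y ⟶ X)) : Prop where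
  /-- `X` is integral (a variety, 2.9) -/
  isIntegral : IsIntegral X
  /-- (iii) `X` is projective over `k` -/
  isProjectiveOver : Literature.AlgebraicGeometry.Motives.IsProjectiveOver (Over.mk (f ≫ g))
  /-- `Y` is integral (a variety) -/
  isIntegral_base : IsIntegral Y
  /-- `Y` is projective over `k` -/
  isProjectiveOver_base : Literature.AlgebraicGeometry.Motives.IsProjectiveOver (Over.mk g)
  /-- `Y` is nonsingular -/
  isRegular_base : Scheme.IsRegular Y
  /-- `D ⊂ Y` is a divisor with strict normal crossings -/
  isStrictNormalCrossingsDivisor : IsStrictNormalCrossingsDivisor Y D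
  /-- `f : X → Y` is a semi-stable curve -/
  isSemiStableCurve : IsSemiStableCurve f
  /-- `f` is smooth over `Y ∖ D` -/
  smooth_morphismRestrict :
    Smooth (f ∣_ ⟨Dᶜ, isStrictNormalCrossingsDivisor.isClosed.isOpen_compl⟩)
  /-- the `τᵢ` are sections of `f` -/
  comp_eq_id : ∀ i, τ i ≫ f = 𝟙 Y
  /-- the sections are mutually disjoint -/
  pairwise_disjoint : Pairwise fun i j => Disjoint (Set.range (τ i)) (Set.range (τ j))
  /-- the sections map into the smooth locus of `f` -/
  exists_smooth : ∀ i, ∃ U : X.Opens, Set.range (τ i) ⊆ (U : Set X) ∧ Smooth (U.ι ≫ f)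

/-- The boundary of Situation 4.23: `Z = τ₁(Y) ∪ … ∪ τₙ(Y) ∪ f⁻¹(D)`.
[cite: DeJong1996, 4.23, p. 75] -/
def semiStableBoundary {X Y : Scheme.{u}} (f : X ⟶ Y) (D : Set Y) {n : ℕ}
    (τ : Fin n → (Y ⟶ X)) : Set X :=
  (⋃ i, Set.range (τ i)) ∪ f ⁻¹' D

/-- Unfolding `semiStableBoundary`. [folklore] -/
theorem mem_semiStableBoundary_iff {X Y : Scheme.{u}} (f : X ⟶ Y) (D : Set Y) {n : ℕ}
    (τ : Fin n → (Y ⟶ X)) (x : X) :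
    x ∈ semiStableBoundary f D τ ↔ (∃ i, x ∈ Set.range (τ i)) ∨ f x ∈ D := by
  simp [semiStableBoundary]

namespace SemiStablePair

variable {k : Type u} [Field k] {X Y : Scheme.{u}} {f : X ⟶ Y} {g : Y ⟶ Spec (.of k)}
  {D : Set Y} {n : ℕ} {τ : Fin n → (Y ⟶ X)}

/-- In Situation 4.23, `X → Spec k` is proper. [folklore] -/
theorem isProper (h : SemiStablePair f g D τ) : IsProper (f ≫ g) :=
  Literature.AlgebraicGeometry.Motives.IsProjectiveOver.isProper (X := Over.mk (f ≫ g))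
    h.isProjectiveOver

/-- In Situation 4.23, `X → Spec k` is separated. [folklore] -/
theorem isSeparated (h : SemiStablePair f g D τ) : IsSeparated (f ≫ g) :=
  haveI := h.isProper
  inferInstance

/-- In Situation 4.23, `X → Spec k` is locally of finite type. [folklore] -/
theorem locallyOfFiniteType (h : SemiStablePair f g D τ) : LocallyOfFiniteType (f ≫ g) :=
  haveI := h.isProper
  inferInstance

/-- In Situation 4.23, `X → Spec k` is quasi-compact. [folklore] -/
theorem quasiCompact (h : SemiStablePair f g D τ) : QuasiCompact (f ≫ g) :=
  haveI := h.isProper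
  inferInstance

/-- The sections of Situation 4.23 are closed immersions (sections of the separated `f`).
[folklore] -/
theorem isClosedImmersion (h : SemiStablePair f g D τ) (i : Fin n) : IsClosedImmersion (τ i) :=
  haveI := h.isSemiStableCurve.isSeparated
  haveI : IsClosedImmersion (τ i ≫ f) := by rw [h.comp_eq_id i]; infer_instance
  .of_comp (τ i) f

/-- The boundary `Z = ⋃ᵢ τᵢ(Y) ∪ f⁻¹(D)` of Situation 4.23 is closed. [folklore] -/
theorem isClosed_semiStableBoundary (h : SemiStablePair f g D τ) :
    IsClosed (semiStableBoundary f D τ) := by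
  refine IsClosed.union (isClosed_iUnion_of_finite fun i => ?_)
    (h.isStrictNormalCrossingsDivisor.isClosed.preimage f.continuous)
  haveI := h.isClosedImmersion i
  exact (τ i).isClosedEmbedding.isClosed_range

/-- In Situation 4.23, `f` maps the generic point of `X` to the generic point of `Y` (`f` is
flat of finite presentation, hence open, hence dominant). [folklore] -/
theorem apply_genericPoint (h : SemiStablePair f g D τ) :
    haveI := h.isIntegral
    haveI := h.isIntegral_base
    f (genericPoint X) = genericPoint Y := by
  haveI := h.isIntegral
  haveI := h.isIntegral_base
  haveI := h.isSemiStableCurve.isDominant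
  exact genericPoint_eq_of_isDominant f

/-- In Situation 4.23 the generic point of `X` does not lie over `D`. [folklore] -/
theorem genericPoint_notMem_preimage (h : SemiStablePair f g D τ) :
    haveI := h.isIntegral
    genericPoint X ∉ f ⁻¹' D := by
  haveI := h.isIntegral
  haveI := h.isIntegral_base
  intro hη
  rw [Set.mem_preimage, h.apply_genericPoint] at hη
  exact h.isStrictNormalCrossingsDivisor.genericPoint_notMem hη

/-- In Situation 4.23 the generic point of `X` lies on no section `τᵢ(Y)`: otherwise the closed
subset `τᵢ(Y)` is all of `X`, the closed immersion `τᵢ` is an isomorphism with inverse `f`, and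
every geometric fibre of `f` is a reduced point `Spec K`, whose only point is closed with local
ring the field `K` — neither regular of dimension `1` nor an ordinary double point (the complete
local ring of a node is not a domain). [folklore] -/
theorem genericPoint_notMem_range (h : SemiStablePair f g D τ) (i : Fin n) :
    haveI := h.isIntegral
    genericPoint X ∉ Set.range (τ i) := by
  haveI := h.isIntegral
  haveI := h.isIntegral_base
  haveI := h.isClosedImmersion i
  intro hη
  -- `τᵢ(Y)` is closed and contains the generic point: `τᵢ` is surjective, hence an isomorphism
  have hcl : IsClosed (Set.range (τ i)) := (τ i).isClosedEmbedding.isClosed_range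
  have huniv : Set.range (τ i) = Set.univ := by
    have hsub := ((genericPoint_spec X).mem_closed_set_iff hcl).mp hη
    exact Set.eq_univ_of_univ_subset (by simpa using hsub)
  haveI : Surjective (τ i) := ⟨Set.range_eq_univ.mp huniv⟩
  haveI : IsIso (τ i) := isIso_of_isClosedImmersion_of_surjective (τ i)
  have hf : f = inv (τ i) := IsIso.eq_inv_of_hom_inv_id (h.comp_eq_id i)
  haveI : IsIso f := by rw [hf]; infer_instance
  -- a geometric point of `Y` and its fibre, which is `Spec K`
  let K : Type u := AlgebraicClosure (Y.residueField (genericPoint Y))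
  let s : Spec (.of K) ⟶ Y :=
    Spec.map (CommRingCat.ofHom (algebraMap (Y.residueField (genericPoint Y)) K)) ≫
      Y.fromSpecResidueField (genericPoint Y)
  haveI : IsIntegral (pullback f s) := IsIntegral.of_isIso (inv (pullback.snd f s))
  haveI : Subsingleton (Spec (CommRingCat.of K)) :=
    inferInstanceAs (Subsingleton (PrimeSpectrum K))
  haveI : Subsingleton ↥(pullback f s) := (pullback.snd f s).isOpenEmbedding.injective.subsingleton
  have hpt : ({genericPoint (pullback f s : Scheme.{u})} : Set ↥(pullback f s)) = Set.univ :=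
    Set.eq_univ_of_forall fun z => Subsingleton.elim z _
  have hx : IsClosed ({genericPoint (pullback f s : Scheme.{u})} : Set ↥(pullback f s)) := by
    rw [hpt]
    exact isClosed_univ
  have hF : IsField ((pullback f s).presheaf.stalk (genericPoint (pullback f s : Scheme.{u}))) :=
    isField_stalk_of_closure_mem_irreducibleComponents (pullback f s) _
      (by simp [irreducibleComponents_eq_singleton, hpt])
  rcases h.isSemiStableCurve.isRegularLocalRing_or_isOrdinaryDoublePoint K s _ hx with
    ⟨-, hdim⟩ | hnode
  · rw [ringKrullDim_eq_zero_of_isField hF] at hdim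
    exact zero_ne_one hdim
  · exact IsOrdinaryDoublePoint.not_of_isField K hF hnode

/-- In Situation 4.23 the generic point of `X` is not in the boundary `Z`. [folklore] -/
theorem genericPoint_notMem_semiStableBoundary (h : SemiStablePair f g D τ) :
    haveI := h.isIntegral
    genericPoint X ∉ semiStableBoundary f D τ := by
  haveI := h.isIntegral
  rw [mem_semiStableBoundary_iff]
  rintro (⟨i, hi⟩ | hD)
  · exact h.genericPoint_notMem_range i hi
  · exact h.genericPoint_notMem_preimage hD

/-- In Situation 4.23 the boundary `Z` is a proper closed subset of `X`. [folklore] -/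
theorem semiStableBoundary_ne_univ (h : SemiStablePair f g D τ) :
    semiStableBoundary f D τ ≠ Set.univ := fun e =>
  h.genericPoint_notMem_semiStableBoundary (e ▸ Set.mem_univ _)

/-- Sanity of the cut: a pair `(X, Z)` in Situation 4.23 is a pair as in Thm. 4.1 (`X` a
variety over `k`, `Z ⊂ X` a proper closed subset), so Thm. 4.1 with its generically-étale clause
over algebraically closed fields (`DeJong1996StrongAlgClosed`) serves it. [folklore] -/
theorem conclusionGenericallyEtale_of_strongAlgClosed [IsAlgClosed k] (h : SemiStablePair f g D τ)
    (H : DeJong1996StrongAlgClosed.{u}) :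
    ConclusionGenericallyEtale (f ≫ g) (semiStableBoundary f D τ) :=
  H k X (f ≫ g) (semiStableBoundary f D τ) h.isSeparated h.locallyOfFiniteType h.quasiCompact
    h.isIntegral h.isClosed_semiStableBoundary h.semiStableBoundary_ne_univ

end SemiStablePair

end DeJong1996

/-! ## 4.11–4.22 and 4.23–4.28 as named facts -/

/-- NAMED FACT — **de Jong 1996, 4.11–4.22: reduction of a normal projective pair to a
semi-stable pair (Situation 4.23), using the induction hypothesis on the base.** Over an
algebraically closed field `k`, assume Thm. 4.1 with its generically-étale clause for all pairs
over `k` of dimension `≤ d` (`DeJong1996.StatementUpToDim k d`), and let `(X, Z)` satisfy (iii)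
`X` projective, (iv) `Z` the support of a divisor, (v) `X` normal
(`DeJong1996.NormalProjectivePair`)
with `dim X = d + 1`. Then Thm. 4.1 with the clause for `(X, Z)` follows from Thm. 4.1 with the
clause for every pair `(X', Z')` in Situation 4.23 over `k` (`DeJong1996.SemiStablePair`,
`Z' = ⋃ᵢ τᵢ(Y') ∪ f'⁻¹(D')`) with `dim X' = dim X`. This is the content of Lemma 4.11 (blowing up
a finite set of regular closed points off `Z` — a modification — to get `f : X' → 𝐏^d_k` with
one-dimensional fibres, smooth locus dense in the fibres, `Z' → 𝐏^d` finite and generically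
étale, one smooth fibre; proof by generic projections 2.11 and Bertini), 4.12 (2.8 and Stein
factorisation; `Y' → 𝐏^d` finite étale forces `Y' = 𝐏^d` [18], so all fibres are geometrically
connected: (vi) a)–d)), Lemma 4.13–4.14 (a divisor `H` finite generically étale over `Y` with
`≥ 3` smooth points on each component of each geometric fibre; `Z ↦ Z ∪ H` by 4.9: (vi) e)),
4.15 (strict transforms along generically étale projective alterations of `Y` preserve (i),
(iii), (iv), (vi) a)–e)), 4.16 (Galois normalisation of `Y`: (vi) f) `Z = ⋃ σᵢ(Y)`), 4.17 (the
smooth stable `n`-pointed curve over the open `U ⊂ Y`, `n ≥ 3`, extends over the closure `Y'`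
of a level-`ℓ` cover `U'` in `Y × ℓM̄_{g,n}`, 2.24: (vi) g) a stable `n`-pointed curve
`(𝒞, τ₁, …, τₙ)` over `Y` with `β : 𝒞_U ≅ X_U`), 4.18–4.21 (flattening 2.19, normalisation of
the base, the three-point Lemma 4.20 and Serre's criterion: after a modification of `Y` the
rational map `β` extends to a birational morphism `β : 𝒞 → X`), and 4.22 ("We replace `X` by `𝒞`
and `Z` by `τ₁(Y) ∪ … ∪ τₙ(Y) ∪ f⁻¹(D)`, see 4.4 and 4.9. At this point we apply the induction
hypothesis: there exists a nonsingular projective variety `Y'` and a generically étale alteration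
`ψ : Y' → Y` such that the closed subset `ψ⁻¹(D)` is a strict normal crossings divisor on `Y'`
[`dim Y = d`]. Pulling back the family `𝒞` to a family `𝒳` over `Y'` and applying 4.4 once
again, we reduce to the situation described in 4.23"). Each replacement of `(X, Z)` is along a
generically étale alteration (4.4, `DeJong1996.ConclusionGenericallyEtale.of_isAlteration`),
which preserves the dimension, or an enlargement of `Z` (4.9). Users take
`(h : DeJong1996ReductionToSemiStablePair)`; it is a node to decompose further.
[cite: DeJong1996, 4.11–4.22, pp. 67–75] -/
def DeJong1996ReductionToSemiStablePair : Prop :=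
  ∀ (k : Type u) [Field k] [IsAlgClosed k] (d : ℕ), DeJong1996.StatementUpToDim k d →
    ∀ (X : Scheme.{u}) (f : X ⟶ Spec (.of k)) (Z : Set X), DeJong1996.NormalProjectivePair f Z →
      topologicalKrullDim X = (d + 1 : ℕ) →
        (∀ (X' Y' : Scheme.{u}) (f' : X' ⟶ Y') (g' : Y' ⟶ Spec (.of k)) (D' : Set Y') (n : ℕ)
            (τ : Fin n → (Y' ⟶ X')), DeJong1996.SemiStablePair f' g' D' τ →
            topologicalKrullDim X' = topologicalKrullDim X →
              DeJong1996.ConclusionGenericallyEtale (f' ≫ g')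
                (DeJong1996.semiStableBoundary f' D' τ)) →
          DeJong1996.ConclusionGenericallyEtale f Z

/-- NAMED FACT — **de Jong 1996, 4.23–4.28 (with Lemma 3.2, 3.5 and 2.4): resolution of a
semi-stable pair.** Over an algebraically closed field `k`, Thm. 4.1 with its generically-étale
clause holds for every pair `(X, Z)` in Situation 4.23 (`DeJong1996.SemiStablePair f g D τ`,
`Z = ⋃ᵢ τᵢ(Y) ∪ f⁻¹(D)`): "4.24. Using the modification of Lemma 3.2 we reduce to the situation
4.23, where we have in addition that `codim(Sing(X), X) ≥ 3`. (… `Z` is already everywhere a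
divisor with normal crossings, except in the singular points of `X`. Furthermore, it is a
divisor …) The situation is further explained in 3.5 [complete local rings
`k⟦u, v, t₁, …, t_{d-1}⟧/(uv - t₁ ⋯ t_μ)`, `Z = {t₁ ⋯ t_r = 0}`, the components of `Sing(X)`
nonsingular: Situation 4.25] … 4.26. Let `E ⊂ X` be an irreducible component of `Sing(X)`. Let
`π : X' → X` be the blowing up of `X` in the ideal sheaf of `E` … 4.27. Claim. The pair
`(X', Z')` is as described in 4.25. The number of components of `Sing(X')` is one less than the
number of components of `Sing(X)`. … 4.28. By repeatedly blowing up `(X, Z)` as in 4.26 we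
finally get the situation that `X` is nonsingular and `Z` is a normal crossings divisor. It is
well known that by blowing up `X` further we can reach the situation where `Z` has strict normal
crossings, see 2.4. This finishes the proof of Theorem 4.1." (The solution produced is a
modification `φ₁ : X₁ → X`, a composition of blow-ups of the projective `X`, with `X̄₁ = X₁`; a
modification is a generically étale alteration.) Users take
`(h : DeJong1996SemiStablePairResolution)`; it is a node to decompose further.
[cite: DeJong1996, 4.23–4.28, pp. 75–76] -/
def DeJong1996SemiStablePairResolution : Prop :=
  ∀ (k : Type u) [Field k] [IsAlgClosed k] (X Y : Scheme.{u}) (f : X ⟶ Y)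
    (g : Y ⟶ Spec (.of k)) (D : Set Y) (n : ℕ) (τ : Fin n → (Y ⟶ X)),
    DeJong1996.SemiStablePair f g D τ →
      DeJong1996.ConclusionGenericallyEtale (f ≫ g) (DeJong1996.semiStableBoundary f D τ)

/-! ## The assembly -/

/-- **de Jong 1996, 4.11–4.28 from its two printed halves**: the reduction to Situation 4.23
(4.11–4.22, `DeJong1996ReductionToSemiStablePair`) and the resolution of Situation 4.23 (4.23–4.28,
`DeJong1996SemiStablePairResolution`) give the induction step for normal projective pairs
`DeJong1996NormalProjectiveStep`. [cite: DeJong1996, 4.11–4.28, pp. 67–76] -/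
theorem DeJong1996NormalProjectiveStep.of_semiStablePair
    (hred : DeJong1996ReductionToSemiStablePair.{u})
    (hres : DeJong1996SemiStablePairResolution.{u}) : DeJong1996NormalProjectiveStep.{u} :=
  fun k _ _ d ih X f Z hP hdim =>
    hred k d ih X f Z hP hdim fun X' Y' f' g' D' n τ hS _ => hres k X' Y' f' g' D' n τ hS

/-- Conversely (sanity of the cut), the step 4.11–4.28 trivially gives its first half.
[folklore] -/
theorem DeJong1996ReductionToSemiStablePair.of_normalProjectiveStep
    (h : DeJong1996NormalProjectiveStep.{u}) : DeJong1996ReductionToSemiStablePair.{u} :=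
  fun k _ _ d ih X f Z hP hdim _ => h k d ih X f Z hP hdim

/-- Sanity of the cut: the second half is a special case of Thm. 4.1 over algebraically closed
fields (`DeJong1996.SemiStablePair.conclusionGenericallyEtale_of_strongAlgClosed`). [folklore] -/
theorem DeJong1996SemiStablePairResolution.of_strongAlgClosed (H : DeJong1996StrongAlgClosed.{u}) :
    DeJong1996SemiStablePairResolution.{u} :=
  fun _k _ _ _X _Y _f _g _D _n _τ h => h.conclusionGenericallyEtale_of_strongAlgClosed H

/-- The induction step 4.6–4.28 (`DeJong1996InductionStep`) from the three vendored blocks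
4.6–4.10, 4.11–4.22, 4.23–4.28. [cite: DeJong1996, 4.6–4.28, pp. 66–76] -/
theorem DeJong1996InductionStep.of_reduction_of_semiStablePair
    (hred : DeJong1996NormalProjectiveReduction.{u}) (hss : DeJong1996ReductionToSemiStablePair.{u})
    (hres : DeJong1996SemiStablePairResolution.{u}) : DeJong1996InductionStep.{u} :=
  DeJong1996InductionStep.of_reduction_of_step hred
    (DeJong1996NormalProjectiveStep.of_semiStablePair hss hres)

/-- Over an algebraically closed field: 4.3, 4.6–4.10, 4.11–4.22 and 4.23–4.28 give Thm. 4.1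
with its generically-étale clause in every dimension. [cite: DeJong1996, 4.3–4.28, pp. 66–76] -/
theorem DeJong1996StrongAlgClosed.of_reduction_of_semiStablePair
    (hred : DeJong1996NormalProjectiveReduction.{u}) (hss : DeJong1996ReductionToSemiStablePair.{u})
    (hres : DeJong1996SemiStablePairResolution.{u}) : DeJong1996StrongAlgClosed.{u} :=
  DeJong1996StrongAlgClosed.of_inductionStep
    (DeJong1996InductionStep.of_reduction_of_semiStablePair hred hss hres)

/-- **Assembly of the printed proof of Thm. 4.1 from four vendored blocks**: 4.5
(`DeJong1996Descent`), 4.6–4.10 (`DeJong1996NormalProjectiveReduction`), 4.11–4.22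
(`DeJong1996ReductionToSemiStablePair`) and 4.23–4.28 (`DeJong1996SemiStablePairResolution`).
[cite: DeJong1996, 4.3–4.28, pp. 66–76] -/
theorem DeJong1996Strong.of_descent_of_reduction_of_semiStablePair (h45 : DeJong1996Descent.{u})
    (hred : DeJong1996NormalProjectiveReduction.{u}) (hss : DeJong1996ReductionToSemiStablePair.{u})
    (hres : DeJong1996SemiStablePairResolution.{u}) : DeJong1996Strong.{u} :=
  DeJong1996Strong.of_descent_of_inductionStep h45
    (DeJong1996InductionStep.of_reduction_of_semiStablePair hred hss hres)

/-- The same assembly gives the last sentence of Thm. 4.1 (perfect ground fields).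
[cite: DeJong1996, 4.3–4.28, pp. 66–76] -/
theorem DeJong1996StrongPerfect.of_descent_of_reduction_of_semiStablePair
    (h45 : DeJong1996Descent.{u}) (hred : DeJong1996NormalProjectiveReduction.{u})
    (hss : DeJong1996ReductionToSemiStablePair.{u})
    (hres : DeJong1996SemiStablePairResolution.{u}) : DeJong1996StrongPerfect.{u} :=
  DeJong1996StrongPerfect.of_descent_of_inductionStep h45
    (DeJong1996InductionStep.of_reduction_of_semiStablePair hred hss hres)

/-- `DeJong1996Projective` (Thm. 4.1 (i)) from the four vendored blocks.
[cite: DeJong1996, Thm. 4.1, p. 66] -/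
theorem DeJong1996Projective.of_descent_of_reduction_of_semiStablePair (h45 : DeJong1996Descent.{u})
    (hred : DeJong1996NormalProjectiveReduction.{u}) (hss : DeJong1996ReductionToSemiStablePair.{u})
    (hres : DeJong1996SemiStablePairResolution.{u}) : DeJong1996Projective.{u} :=
  (DeJong1996Strong.of_descent_of_reduction_of_semiStablePair h45 hred hss hres).projective

end Literature.AlgebraicGeometry.Resolution

end
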